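import Literature.MathematicalPhysics.QuantumFieldTheory.Balaban1983to89.B9Eq371BondPrincipalTwoBackgroundSplit

/-!
# `Balaban1983to89.B9Eq373BondPrincipalTwoBackgroundLetter` — T. Bałaban, *Propagators for lattice gauge theories in a background field*, Commun. Math. Phys. **99** (1985)
# 389–434 [Balaban1985BackgroundPropagators] (3.73) p. 405 with (3.84)–(3.85) p. 407 (*«Using the bounds (3.73), (3.77), (3.83) and assuming that Theorem 3.3 holds for G(U),
# we get |(V(A)G(U)J)(b)| ≤ O(1)α₁e^{−(1/2)δ₀d(y,y′)}|J| … hence V(A)G(U) is a small operator in supremum norm»*): **THE PRINCIPAL-PART PIECE OF (3.85) IN THE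
# CHAIN's LOCAL-LETTER CURRENCY** — if a bond function `A` (think `A = G(1)f`, `f` supported over one block `v`) has the VALUE letter `‖A(x,μ)‖ ≤ B·e^{−κ d(πx, v)}·F`
# and the FLAT-GRADIENT letter `‖(∇_1A)((x,μ),ν)‖ ≤ B′·e^{−κ d(πx, v)}·F`, then the two-background difference of the principal part satisfies
# `‖((D*_SD_R − D*_1D_1)A)(y,κ′)‖ ≤ 4N_q((‖c‖²ε² + ‖c‖²ε′)B + 2‖c‖εB′)·e^{2κρ}·e^{−κ d(πy, v)}·F` — a LETTER for `(D*_SD_R − D*_1D_1)∘G(1)` with the small factor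
# (every coefficient `O(α)` on the model), for ABSTRACT transporters as in `B9Eq371BondPrincipalTwoBackgroundSplit` and an abstract block map `π` whose distance to `v`
# drops by at most `ρ` per unit step

statement-level skeleton of published theorems with citation tags; proofs where landed; nothing here is a claim about the Yang–Mills mass gap

CITATION HEADER (lean-in-tree rule).  Audit cell `pub-balaban`, sub-cell `t4`, BINDER row NE9; NE9 crux-team LEAF PROVER 01 (`b2b-balaban-t4-ne9-formalise-leaf-01`, gen 100;
bears_on: R4/N22) — brick G-2 of the bond-propagator storey (J′-G).  Composition BY NAME of this gen's `B9Eq371BondPrincipalTwoBackgroundSplit.norm_covLapPrincipal_sub_flat_apply_le`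
with [folklore] `exp` bookkeeping; the letter SHAPE is the chain's (L) of `B9Eq326G1SupRowOfLetters` ∕ `B9Eq326G1kSupRowClosed` ∕ `B9Eq326G1kSliceGradRowClosed` (value and covariant-gradient
rows of `G₁,k`).  Sources: [Balaban1985BackgroundPropagators] pp. 405, 407 (text layer pp. 17, 19 read by this lineage 2026-08-28).  NOTHING of print's proof is reproduced.

WHAT IS PROVED (sorry-free; proof lane — no `def`).
* `exp_step_le`, `exp_two_steps_le` — the decay bookkeeping along one ∕ two unit steps.
* **`norm_covLapPrincipal_sub_flat_apply_le_of_letters`** — the bound of the title.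
HONEST SCOPE.  Abstract transporters and block map; no propagator of the chain is named here (the instantiation `A := G₁,k(1)f` with the chain's rows, the curvature piece
`Δ′(U)` (`B9Eq369CurvOpSupLetter.norm_apply_curvOp_le_local`) and the `DRD*`, `Q*aQ` members are the next bricks); constants crude.  NE9 NOT PRINTED ∕ NOT PROVED; spine PROVED 0∕9;
rung (B)+1 finite T⁴ — NOT infinite volume, NOT mass gap, NOT BetaPertH, NOT Clay.  HONEST DEPENDENCY: continuum YM on T⁴ ⇐ BetaPertH ∧ nine spine estimates (0/9 proved); BetaPertH ⇐
(D1) ∧ (D4) ∧ CAP+tail; G-an2-4 gates asym, D1 and NE2/3/4.  NEW file; nothing modified.  Net new unproved facts: 0.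
-/

noncomputable section

open scoped BigOperators

namespace Literature.MathematicalPhysics.QuantumFieldTheory.Balaban1983to89.B9Eq373BondPrincipalTwoBackgroundLetter

open B4Sect5Torus (TSite)
open B9SectCLatticeCarrier (Bond Plaq DirPair shift unshift)
open B9Eq33CovDerivVector (covGrad)
open B9Eq34CovCurlVector (covLapPrincipal)
open B9Eq371BondPrincipalTwoBackgroundSplit (norm_covLapPrincipal_sub_flat_apply_le)

variable {d : ℕ} {P : Fin d → ℕ} {W : Type*} [NormedAddCommGroup W] [NormedSpace ℂ W] {Y : Type*}

/-! ## §1 Decay bookkeeping along unit steps -/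

/-- One step: if `d(πx) ≤ d(πx′) + ρ` then `e^{−κd(πx′)} ≤ e^{κρ}·e^{−κd(πx)}` (`κ ≥ 0`). [folklore] [cite: Balaban1985BackgroundPropagators, (3.85) p.407] -/
theorem exp_step_le {κ ρ a a' : ℝ} (hκ : 0 ≤ κ) (h : a ≤ a' + ρ) :
    Real.exp (-(κ * a')) ≤ Real.exp (κ * ρ) * Real.exp (-(κ * a)) := by
  rw [← Real.exp_add]
  exact Real.exp_le_exp.mpr (by nlinarith [mul_le_mul_of_nonneg_left h hκ])

/-- Two steps: `d(πx) ≤ d(πx′) + ρ`, `d(πx′) ≤ d(πx″) + ρ` ⟹ `e^{−κd(πx″)} ≤ e^{2κρ}·e^{−κd(πx)}`. [folklore] [cite: Balaban1985BackgroundPropagators, (3.85) p.407] -/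
theorem exp_two_steps_le {κ ρ a a' a'' : ℝ} (hκ : 0 ≤ κ) (h : a ≤ a' + ρ) (h' : a' ≤ a'' + ρ) :
    Real.exp (-(κ * a'')) ≤ Real.exp (2 * κ * ρ) * Real.exp (-(κ * a)) := by
  rw [← Real.exp_add]
  exact Real.exp_le_exp.mpr (by nlinarith [mul_le_mul_of_nonneg_left h hκ, mul_le_mul_of_nonneg_left h' hκ])

/-! ## §2 The letter -/

section Letter

variable (c : ℂ) (R S : Bond d P → W →ₗ[ℂ] W)

/-- **THE PRINCIPAL-PART PIECE OF (3.85) AS A LOCAL LETTER** — abstract transporters (`‖R(b)w − w‖, ‖S(b)w − w‖ ≤ ε‖w‖`, variation `‖R(x−e_λ,μ)w − R(x,μ)w‖ ≤ ε′‖w‖`,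
`c ≠ 0`), a block map `π : sites → Y` with a distance-to-`v` function `dv` that drops by at most `ρ ≥ 0` per forward or backward unit step, and a bond function `A` with the
VALUE letter `‖A(x,μ)‖ ≤ B·e^{−κ·dv(πx)}·F` and the FLAT-GRADIENT letter `‖(∇_1A)((x,μ),ν)‖ ≤ B′·e^{−κ·dv(πx)}·F` (`κ, B, B′, F ≥ 0`):
`‖((D*_SD_RA) − (D*_1D_1A))(y,κ′)‖ ≤ 4N_q·((‖c‖²ε² + ‖c‖²ε′)·B + 2‖c‖ε·B′)·e^{2κρ}·e^{−κ·dv(πy)}·F`.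
[cite: Balaban1985BackgroundPropagators, (3.73) p.405, (3.84)–(3.85) p.407] -/
theorem norm_covLapPrincipal_sub_flat_apply_le_of_letters (hc : c ≠ 0) {ε ε' : ℝ} (hε : 0 ≤ ε) (hε' : 0 ≤ ε')
    (hRε : ∀ b w, ‖R b w - w‖ ≤ ε * ‖w‖) (hSε : ∀ b w, ‖S b w - w‖ ≤ ε * ‖w‖)
    (hRε' : ∀ (x : TSite d P) (lam μ : Fin d) (w : W), ‖R (unshift lam x, μ) w - R (x, μ) w‖ ≤ ε' * ‖w‖)
    (π : TSite d P → Y) (dv : Y → ℝ) {ρ κ B B' F : ℝ} (hρ : 0 ≤ ρ) (hκ : 0 ≤ κ) (hB : 0 ≤ B) (hB' : 0 ≤ B') (hF : 0 ≤ F)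
    (hπs : ∀ (μ : Fin d) (x : TSite d P), dv (π x) ≤ dv (π (shift μ x)) + ρ)
    (hπu : ∀ (μ : Fin d) (x : TSite d P), dv (π x) ≤ dv (π (unshift μ x)) + ρ)
    (A : Bond d P → W)
    (hval : ∀ (x : TSite d P) (μ : Fin d), ‖A (x, μ)‖ ≤ B * Real.exp (-(κ * dv (π x))) * F)
    (hgrad : ∀ (x : TSite d P) (μ ν : Fin d),
      ‖covGrad c (fun _ : Bond d P => (LinearMap.id : W →ₗ[ℂ] W)) A ((x, μ), ν)‖ ≤ B' * Real.exp (-(κ * dv (π x))) * F)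
    (y : TSite d P) (k : Fin d) :
    ‖covLapPrincipal c R S A (y, k) - covLapPrincipal c (fun _ : Bond d P => (LinearMap.id : W →ₗ[ℂ] W)) (fun _ => LinearMap.id) A (y, k)‖ ≤
      4 * (Fintype.card (DirPair d) : ℝ) * ((‖c‖ ^ 2 * ε ^ 2 + ‖c‖ ^ 2 * ε') * B + 2 * (‖c‖ * ε) * B') *
        Real.exp (2 * κ * ρ) * Real.exp (-(κ * dv (π y))) * F := by
  -- uniform bounds over the 2-neighbourhood of `y`
  set E := Real.exp (2 * κ * ρ) * Real.exp (-(κ * dv (π y))) with hE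
  have hE0 : 0 ≤ E := mul_nonneg (Real.exp_nonneg _) (Real.exp_nonneg _)
  have h1step : ∀ (lam : Fin d), Real.exp (-(κ * dv (π (unshift lam y)))) ≤ E := fun lam => by
    have h := exp_step_le (κ := κ) hκ (hπu lam y)
    refine h.trans (mul_le_mul_of_nonneg_right (Real.exp_le_exp.mpr ?_) (Real.exp_nonneg _))
    nlinarith [mul_nonneg hκ hρ]
  have h2step : ∀ (lam μ : Fin d), Real.exp (-(κ * dv (π (shift μ (unshift lam y))))) ≤ E := fun lam μ =>
    exp_two_steps_le hκ (hπu lam y) (hπs μ (unshift lam y))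
  have hA1 : ∀ lam μ ν : Fin d, ‖A (shift μ (unshift lam y), ν)‖ ≤ B * E * F := fun lam μ ν =>
    (hval _ _).trans (mul_le_mul_of_nonneg_right (mul_le_mul_of_nonneg_left (h2step lam μ) hB) hF)
  have hD1 : ∀ lam μ ν : Fin d, ‖covGrad c (fun _ : Bond d P => (LinearMap.id : W →ₗ[ℂ] W)) A ((unshift lam y, μ), ν)‖ ≤ B' * E * F := fun lam μ ν =>
    (hgrad _ _ _).trans (mul_le_mul_of_nonneg_right (mul_le_mul_of_nonneg_left (h1step lam) hB') hF)
  have hD2 : ∀ lam μ ν : Fin d, ‖covGrad c (fun _ : Bond d P => (LinearMap.id : W →ₗ[ℂ] W)) A ((shift μ (unshift lam y), lam), ν)‖ ≤ B' * E * F :=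
    fun lam μ ν => (hgrad _ _ _).trans (mul_le_mul_of_nonneg_right (mul_le_mul_of_nonneg_left (h2step lam μ) hB') hF)
  have h := norm_covLapPrincipal_sub_flat_apply_le c R S hc hε hε' hRε hSε hRε' A y hA1 hD1 hD2 k
  refine h.trans (le_of_eq ?_)
  rw [hE]
  ring

end Letter

end Literature.MathematicalPhysics.QuantumFieldTheory.Balaban1983to89.B9Eq373BondPrincipalTwoBackgroundLetter

end
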